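import Literature.AlgebraicGeometry.ModuliOfAbelianVarieties.SiegelFamilyIsogenyInducedPolarisation
import Literature.AlgebraicGeometry.ModuliOfAbelianVarieties.SiegelFamilyHeckeOrbitsIsogenyDegrees
import HarnessLib

/-!
# Orr's `q` composes like Lange's `τ(α, f) = α'fα`; multipliers multiply; and on a member of Picard number one EVERY
# isogeny is polarised: `q` is a scalar, every isogeny degree is a `g`-th power, and `Tr(A'A) = 2g·(deg A)^{1/g}`

Layer `Literature/AlgebraicGeometry/ModuliOfAbelianVarieties`, namespace
`Literature.AlgebraicGeometry.ModuliOfAbelianVarieties.SiegelModuli`; lane `lit-hodgefound` (Track 2, Layer A4), seat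
`lit-hodgefound-skel-4`, row A4-150 of `run/shared/lean/pub/lit-hodgefound/SKELETON.md` — corollary row closing the
generation-50 thread (rows A4-143 `SiegelFamilyHeckeOrbitsIsogenyDegrees`: `deg = n^g` for a polarised isogeny, the
multiplier is a positive integer; A4-134 §5: on Picard number one every isogeny is polarised and the Hecke orbit is the
isogeny class; A4-147 `SiegelFamilyIsogenyInducedPolarisation`: Orr's `q = A'A`, «polarised ⟺ `q` scalar»; A4-148
`SiegelFamilyHomRosatiNorm`: `Tr(A'A) ≥ 2g·(deg A)^{1/g}`, sibling, not imported).  THEOREMS ONLY (D-0026, net debt 0).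

## Sources, verbatim

* M. Orr, J. reine angew. Math. 705 (2015) [`paper:arxiv-1209.3653`], §3.1 (p0009 L40–L41): «By the hypothesis
  `End A_s = ℤ` this isogeny is polarised»; §1 (p0003 L41): «If the point `s` is Galois generic, then the isogeny class
  and the Hecke orbit coincide»; §2.2 (p0006 L3–L6): «`s` and `t` are in the same Hecke orbit if and only if there is
  a polarised isogeny […] `f^*λ_t = n.λ_s`»; §4.3 (p0012 L66–L68): «`h^*λ' = λ ∘ q`».
* H. Lange, *Abelian Varieties over the Complex Numbers* (2023), §2.4.2 Lemma 2.4.15 (p0119 L34–L42): «`τ(α, f) =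
  α' f α`»; §1.1.2 Prop. 1.1.13 (p0022) (`deg = |det ρ_r|`); §1.7 Cor. 1.7.6 (p0073) («`χ(f^*L) = deg f · χ(L)`»);
  §1.3.1 Exercise 1.3.4 (10) (p0042) (the Picard number).

## What is proved (`A₁ : X_{Z''} → X_{Z'}`, `A₂ : X_{Z'} → X_Z` integer matrices; `q_A := A'A`, `A' = J⁻¹ᵗAJ`)

* §1 COMPOSITION: **`q_{A₂A₁} = A₁' q_{A₂} A₁`** (`rosati_J_mul_mul_self_mul`, Lemma 2.4.15's action law for Orr's
  `q`); **multipliers multiply**: `A₁^*E_{Z'} = n₁E_{Z''}`, `A₂^*E_Z = n₂E_{Z'}` ⟹ `(A₂A₁)^*E_Z = (n₂n₁)E_{Z''}`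
  (`compContinuousLinearMap_realRep_mul_eq_smul`); for a polarised `A` with integer multiplier `n`:
  `Tr(q_A) = Tr(n·1) = 2g·n` and `deg A = n^g` — EQUALITY in A4-148's trace–degree inequality
  (`trace_rosati_J_mul_self_eq_of_eq_smul`, `cast_trace_rosati_J_mul_self_eq_rpow_of_eq_smul`).
* §2 PICARD NUMBER ONE (`ρ(X_{Z'}) = rk NS(X_{Z'}) = 1`, e.g. `End(X_{Z'}) = ℤ`; `g ≥ 1`): for EVERY isogeny
  `A : X_{Z'} → X_Z` to another member there is `n ∈ ℤ_{>0}` with `A^*E_Z = n·E_{Z'}` (`exists_eq_natCast_smul_of_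
  finrank_neronSeveriGroup_eq_one`, A4-134 + A4-143), so **`q_A = n·1` is a scalar**, **`deg A = n^g` is a perfect
  `g`-th power** (`exists_natCard_ker_eq_pow_of_finrank_neronSeveriGroup_eq_one`; also for isogenies INTO a member of
  Picard number one), **the degree set `{deg A}` and Orr's complexity lie in `{n^g : n ≥ 1}`**, and
  **`Tr(A'A) = 2g·(deg A)^{1/g}`** for all of them.

## References

* [Orr2013] M. Orr, J. reine angew. Math. 705 (2015), §1 (p0003), §2.2 (p0006), §3.1 (p0009), §4.3 (p0012).
* [Lange2023AbelianVarietiesComplex] H. Lange, Springer (2023), §2.4.2 Lemma 2.4.15 (p0119), §1.1.2 Prop. 1.1.13 (p0022),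
  §1.7 Cor. 1.7.6 (p0073), §1.3.1 Exercise 1.3.4 (10) (p0042).
-/

noncomputable section

open Matrix Module Function Set
open scoped Matrix

namespace Literature.AlgebraicGeometry.ModuliOfAbelianVarieties

namespace SiegelModuli

open Literature.NumberTheory.Automorphic (siegelUpperHalfSpace)
open Literature.NumberTheory.ModularForms Literature.NumberTheory.ModularForms.SiegelUpperHalfSpace
open Literature.NumberTheory.ComplexMultiplication
open Literature.Geometry.Kaehler Literature.Geometry.Kaehler.ComplexTorus

variable {g : ℕ}

/-! ## §1 Composition of Orr's `q` and of multipliers; the trace of a scalar `q` -/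

section Composition

/-- **`q_{A₂A₁} = A₁' q_{A₂} A₁`** for `X_{Z''} →^{A₁} X_{Z'} →^{A₂} X_Z`: Orr's `q` of a composite is Lange's action
`τ(A₁, q_{A₂}) = A₁' q_{A₂} A₁` («`τ(α, f) = α' f α`»; `(A₂A₁)' = A₁'A₂'`, any commutative ring).
[cite: Lange2023AbelianVarietiesComplex, §2.4.2 Lemma 2.4.15 (p0119 L34–L42)] [cite: Orr2013, §4.3 (p0012 L66–L68)] -/
theorem rosati_J_mul_mul_self_mul {R : Type*} [CommRing R] (A₂ A₁ : Matrix (Fin g ⊕ Fin g) (Fin g ⊕ Fin g) R) :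
    rosati (Matrix.J (Fin g) R) (A₂ * A₁) * (A₂ * A₁) =
      rosati (Matrix.J (Fin g) R) A₁ * (rosati (Matrix.J (Fin g) R) A₂ * A₂) * A₁ := by
  rw [rosati_mul (Matrix.isUnit_det_J (Fin g) R)]
  simp only [Matrix.mul_assoc]

/-- If `q_{A₂} = n₂·1` then `q_{A₂A₁} = n₂ · q_{A₁}`. [cite: Lange2023AbelianVarietiesComplex, §2.4.2 Lemma 2.4.15 (p0119 L34–L42)] -/
theorem rosati_J_mul_mul_self_mul_of_eq_smul {R : Type*} [CommRing R] {A₂ A₁ : Matrix (Fin g ⊕ Fin g) (Fin g ⊕ Fin g) R}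
    {n₂ : R} (h₂ : rosati (Matrix.J (Fin g) R) A₂ * A₂ = n₂ • 1) :
    rosati (Matrix.J (Fin g) R) (A₂ * A₁) * (A₂ * A₁) = n₂ • (rosati (Matrix.J (Fin g) R) A₁ * A₁) := by
  rw [rosati_J_mul_mul_self_mul, h₂, Matrix.mul_smul, Matrix.mul_one, Matrix.smul_mul]

/-- **MULTIPLIERS MULTIPLY: `A₁^*E_{Z'} = n₁·E_{Z''}` and `A₂^*E_Z = n₂·E_{Z'}` give `(A₂A₁)^*E_Z = (n₂n₁)·E_{Z''}`**
(through `q`: `q_{A₂A₁} = A₁'(n₂·1)A₁ = n₂n₁·1`; polarised isogenies compose — the Hecke orbit relation is transitive).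
[cite: Orr2013, §2.2 (p0006 L3–L6)] [cite: Lange2023AbelianVarietiesComplex, §2.4.2 Lemma 2.4.15 (p0119 L34–L42)] -/
theorem compContinuousLinearMap_realRep_mul_eq_smul (Z Z' Z'' : siegelUpperHalfSpace g)
    {A₁ A₂ : Matrix (Fin g ⊕ Fin g) (Fin g ⊕ Fin g) ℤ} {n₁ n₂ : ℤ}
    (h₁ : (prinForm Z').compContinuousLinearMap (realRep (prinPeriod Z'') (prinPeriod Z') A₁) = (n₁ : ℝ) • prinForm Z'')
    (h₂ : (prinForm Z).compContinuousLinearMap (realRep (prinPeriod Z') (prinPeriod Z) A₂) = (n₂ : ℝ) • prinForm Z') :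
    (prinForm Z).compContinuousLinearMap (realRep (prinPeriod Z'') (prinPeriod Z) (A₂ * A₁)) =
      ((n₂ * n₁ : ℤ) : ℝ) • prinForm Z'' := by
  rw [compContinuousLinearMap_realRep_eq_smul_iff_rosati_J_mul_self_eq] at h₁ h₂ ⊢
  rw [rosati_J_mul_mul_self_mul_of_eq_smul h₂, h₁, smul_smul]

/-- **`Tr(q) = 2g·n` FOR A POLARISED `A` WITH MULTIPLIER `n`** (`q = n·1_{2g}`): equality in A4-148's trace–degree
inequality `Tr(A'A) ≥ 2g·(deg A)^{1/g}` (`deg A = n^g`, A4-143). [cite: Orr2013, §2.2 (p0006 L3–L6) and §4.3 (p0012 L66–L68)] -/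
theorem trace_rosati_J_mul_self_eq_of_eq_smul (Z Z' : siegelUpperHalfSpace g)
    {A : Matrix (Fin g ⊕ Fin g) (Fin g ⊕ Fin g) ℤ} {n : ℤ}
    (h : (prinForm Z).compContinuousLinearMap (realRep (prinPeriod Z') (prinPeriod Z) A) = (n : ℝ) • prinForm Z') :
    (rosati (Matrix.J (Fin g) ℤ) A * A).trace = 2 * g * n := by
  rw [(compContinuousLinearMap_realRep_eq_smul_iff_rosati_J_mul_self_eq Z Z' A n).1 h, Matrix.trace_smul,
    Matrix.trace_one, Fintype.card_sum, Fintype.card_fin, smul_eq_mul]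
  push_cast
  ring

/-- **`Tr(A'A) = 2g·(deg A)^{1/g}` for a polarised ISOGENY** with (positive integer) multiplier `n`: `deg A = n^g` and
`Tr(A'A) = 2gn` — the equality case of A4-148's inequality. [cite: Orr2013, §2.2 (p0006 L3–L6)] [cite: Lange2023AbelianVarietiesComplex, §1.7 Cor. 1.7.6 (p0073) and §1.1.2 Prop. 1.1.13 (p0022)] -/
theorem cast_trace_rosati_J_mul_self_eq_rpow_of_eq_smul (hg : 0 < g) {Z Z' : siegelUpperHalfSpace g}
    {A : Matrix (Fin g ⊕ Fin g) (Fin g ⊕ Fin g) ℤ} (hA : IsIsogeny (prinPeriod Z') (prinPeriod Z) A) {n : ℕ}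
    (h : (prinForm Z).compContinuousLinearMap (realRep (prinPeriod Z') (prinPeriod Z) A) = (n : ℝ) • prinForm Z') :
    (((rosati (Matrix.J (Fin g) ℤ) A * A).trace : ℤ) : ℝ) =
      2 * (g : ℝ) * ((Nat.card (mapMatrixHom (prinPeriod Z') (prinPeriod Z) A).ker : ℕ) : ℝ) ^ ((g : ℝ)⁻¹) := by
  rw [natCard_ker_eq_pow_of_isIsogeny_of_eq_natCast_smul hA h, Nat.cast_pow,
    Real.pow_rpow_inv_natCast (Nat.cast_nonneg n) hg.ne',
    trace_rosati_J_mul_self_eq_of_eq_smul Z Z' (n := (n : ℤ)) (by rw [Int.cast_natCast]; exact h)]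
  push_cast
  ring

end Composition

/-! ## §2 Picard number one: every isogeny is polarised, `q` is a scalar, degrees are `g`-th powers -/

section PicardOne

variable {Z Z' : siegelUpperHalfSpace g} {A : Matrix (Fin g ⊕ Fin g) (Fin g ⊕ Fin g) ℤ}

/-- **ON PICARD NUMBER ONE EVERY ISOGENY IS POLARISED WITH A POSITIVE INTEGER MULTIPLIER**: for `ρ(X_{Z'}) = 1` and an
isogeny `A : X_{Z'} → X_Z` (`g ≥ 1`) there is `n ∈ ℤ_{>0}` with `A^*E_Z = n·E_{Z'}` («By the hypothesis `End A_s = ℤ`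
this isogeny is polarised»; the real factor of A4-134 is an integer by A4-143). [cite: Orr2013, §3.1 (p0009 L40–L41) and §2.2 (p0006 L3–L6)] -/
theorem exists_eq_natCast_smul_of_finrank_neronSeveriGroup_eq_one (hg : 0 < g)
    (hA : IsIsogeny (prinPeriod Z') (prinPeriod Z) A) (hρ : finrank ℤ (neronSeveriGroup (prinPeriod Z')) = 1) :
    ∃ n : ℕ, 0 < n ∧
      (prinForm Z).compContinuousLinearMap (realRep (prinPeriod Z') (prinPeriod Z) A) = (n : ℝ) • prinForm Z' := by
  obtain ⟨q, -, hq⟩ := exists_eq_smul_of_isIsogeny_of_finrank_neronSeveriGroup_eq_one hA hρ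
  obtain ⟨n, hn, rfl⟩ := exists_coeff_eq_natCast_of_isIsogeny_of_eq_smul hg hA hq
  exact ⟨n, hn, hq⟩

/-- The same for an isogeny INTO a member of Picard number one (`ρ` is an isogeny invariant).
[cite: Orr2013, §3.1 (p0009 L40–L41)] [cite: Lange2023AbelianVarietiesComplex, §7.3.3 Exercise (1)(a) (p0341)] -/
theorem exists_eq_natCast_smul_of_finrank_neronSeveriGroup_eq_one' (hg : 0 < g)
    (hA : IsIsogeny (prinPeriod Z') (prinPeriod Z) A) (hρ : finrank ℤ (neronSeveriGroup (prinPeriod Z)) = 1) :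
    ∃ n : ℕ, 0 < n ∧
      (prinForm Z).compContinuousLinearMap (realRep (prinPeriod Z') (prinPeriod Z) A) = (n : ℝ) • prinForm Z' :=
  exists_eq_natCast_smul_of_finrank_neronSeveriGroup_eq_one hg hA
    (by rw [IsIsogenous.finrank_neronSeveriGroup_eq (prinPeriod Z') (prinPeriod Z) ⟨A, hA⟩, hρ])

/-- **ON PICARD NUMBER ONE ORR'S `q = A'A` IS A SCALAR `n·1`, `n ≥ 1`** (`End^s(X_{Z'}) = ℤ`).
[cite: Orr2013, §3.1 (p0009 L40–L41) and §4.3 (p0012 L66–L68)] -/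
theorem exists_rosati_J_mul_self_eq_smul_of_finrank_neronSeveriGroup_eq_one (hg : 0 < g)
    (hA : IsIsogeny (prinPeriod Z') (prinPeriod Z) A) (hρ : finrank ℤ (neronSeveriGroup (prinPeriod Z')) = 1) :
    ∃ n : ℕ, 0 < n ∧ rosati (Matrix.J (Fin g) ℤ) A * A = (n : ℤ) • 1 := by
  obtain ⟨n, hn, h⟩ := exists_eq_natCast_smul_of_finrank_neronSeveriGroup_eq_one hg hA hρ
  exact ⟨n, hn, (compContinuousLinearMap_realRep_eq_smul_iff_rosati_J_mul_self_eq Z Z' A n).1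
    (by rw [Int.cast_natCast]; exact h)⟩

/-- **ON PICARD NUMBER ONE EVERY ISOGENY DEGREE IS A PERFECT `g`-TH POWER**: `deg A = n^g` with `n` the multiplier.
[cite: Orr2013, §3.1 (p0009 L40–L41) and §2.2 (p0006 L3–L6)] [cite: Lange2023AbelianVarietiesComplex, §1.7 Cor. 1.7.6 (p0073) and §1.1.2 Prop. 1.1.13 (p0022)] -/
theorem exists_natCard_ker_eq_pow_of_finrank_neronSeveriGroup_eq_one (hg : 0 < g)
    (hA : IsIsogeny (prinPeriod Z') (prinPeriod Z) A) (hρ : finrank ℤ (neronSeveriGroup (prinPeriod Z')) = 1) :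
    ∃ n : ℕ, 0 < n ∧ Nat.card (mapMatrixHom (prinPeriod Z') (prinPeriod Z) A).ker = n ^ g := by
  obtain ⟨n, hn, h⟩ := exists_eq_natCast_smul_of_finrank_neronSeveriGroup_eq_one hg hA hρ
  exact ⟨n, hn, natCard_ker_eq_pow_of_isIsogeny_of_eq_natCast_smul hA h⟩

/-- The same for isogenies INTO a member of Picard number one. [cite: Orr2013, §3.1 (p0009 L40–L41)] [cite: Lange2023AbelianVarietiesComplex, §1.7 Cor. 1.7.6 (p0073)] -/
theorem exists_natCard_ker_eq_pow_of_finrank_neronSeveriGroup_eq_one' (hg : 0 < g)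
    (hA : IsIsogeny (prinPeriod Z') (prinPeriod Z) A) (hρ : finrank ℤ (neronSeveriGroup (prinPeriod Z)) = 1) :
    ∃ n : ℕ, 0 < n ∧ Nat.card (mapMatrixHom (prinPeriod Z') (prinPeriod Z) A).ker = n ^ g := by
  obtain ⟨n, hn, h⟩ := exists_eq_natCast_smul_of_finrank_neronSeveriGroup_eq_one' hg hA hρ
  exact ⟨n, hn, natCard_ker_eq_pow_of_isIsogeny_of_eq_natCast_smul hA h⟩

/-- **THE SET OF ISOGENY DEGREES FROM A MEMBER OF PICARD NUMBER ONE LIES IN `{n^g : n ≥ 1}`** — in particular Orr's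
complexity (the least degree, A4-143) of any member of its isogeny class is a `g`-th power.
[cite: Orr2013, §3.1 (p0008 L14 and p0009 L40–L41)] -/
theorem setOf_natCard_ker_isIsogeny_subset_range_pow_of_finrank_neronSeveriGroup_eq_one (hg : 0 < g)
    (hρ : finrank ℤ (neronSeveriGroup (prinPeriod Z')) = 1) (Z : siegelUpperHalfSpace g) :
    {d : ℕ | ∃ A : Matrix (Fin g ⊕ Fin g) (Fin g ⊕ Fin g) ℤ, IsIsogeny (prinPeriod Z') (prinPeriod Z) A ∧
      Nat.card (mapMatrixHom (prinPeriod Z') (prinPeriod Z) A).ker = d} ⊆ {d | ∃ n : ℕ, 0 < n ∧ d = n ^ g} := by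
  rintro d ⟨A, hA, rfl⟩
  obtain ⟨n, hn, h⟩ := exists_natCard_ker_eq_pow_of_finrank_neronSeveriGroup_eq_one hg hA hρ
  exact ⟨n, hn, h⟩

/-- **The complexity of a member of the isogeny class of a Picard-number-one `X_{Z'}` is a `g`-th power.**
[cite: Orr2013, §3.1 (p0008 L14 and p0009 L40–L41)] -/
theorem exists_eq_pow_of_isLeast_natCard_ker_of_finrank_neronSeveriGroup_eq_one (hg : 0 < g)
    (hρ : finrank ℤ (neronSeveriGroup (prinPeriod Z')) = 1) (Z : siegelUpperHalfSpace g) {d : ℕ}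
    (hd : IsLeast {d : ℕ | ∃ A : Matrix (Fin g ⊕ Fin g) (Fin g ⊕ Fin g) ℤ, IsIsogeny (prinPeriod Z') (prinPeriod Z) A ∧
      Nat.card (mapMatrixHom (prinPeriod Z') (prinPeriod Z) A).ker = d} d) :
    ∃ n : ℕ, 0 < n ∧ d = n ^ g :=
  setOf_natCard_ker_isIsogeny_subset_range_pow_of_finrank_neronSeveriGroup_eq_one hg hρ Z hd.1

/-- **ON PICARD NUMBER ONE `Tr(A'A) = 2g·(deg A)^{1/g}` FOR EVERY ISOGENY `A : X_{Z'} → X_Z`** — the trace–degree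
inequality of A4-148 is an equality throughout the isogeny class (every `q` is a scalar).
[cite: Orr2013, §3.1 (p0009 L40–L41)] [cite: Lange2023AbelianVarietiesComplex, §2.4.2 Thm. 2.4.14 (p0119) and §1.7 Cor. 1.7.6 (p0073)] -/
theorem cast_trace_rosati_J_mul_self_eq_rpow_of_finrank_neronSeveriGroup_eq_one (hg : 0 < g)
    (hA : IsIsogeny (prinPeriod Z') (prinPeriod Z) A) (hρ : finrank ℤ (neronSeveriGroup (prinPeriod Z')) = 1) :
    (((rosati (Matrix.J (Fin g) ℤ) A * A).trace : ℤ) : ℝ) =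
      2 * (g : ℝ) * ((Nat.card (mapMatrixHom (prinPeriod Z') (prinPeriod Z) A).ker : ℕ) : ℝ) ^ ((g : ℝ)⁻¹) := by
  obtain ⟨n, -, h⟩ := exists_eq_natCast_smul_of_finrank_neronSeveriGroup_eq_one hg hA hρ
  exact cast_trace_rosati_J_mul_self_eq_rpow_of_eq_smul hg hA h

/-- **ON PICARD NUMBER ONE `Z ∈ ratSimPoints·Z'` FOR EVERY ISOGENY `X_{Z'} → X_Z`** — A4-134's «the isogeny class and
the Hecke orbit coincide», read with the positive integer multiplier. [cite: Orr2013, §1 (p0003 L41), §2.2 (p0006 L3–L6) and §3.1 (p0009 L40–L41)] -/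
theorem mem_orbit_ratSimPoints_of_isIsogeny_of_finrank_neronSeveriGroup_eq_one
    (hA : IsIsogeny (prinPeriod Z') (prinPeriod Z) A) (hρ : finrank ℤ (neronSeveriGroup (prinPeriod Z')) = 1) :
    Z' ∈ MulAction.orbit (ratSimPoints (Fin g)) Z := by
  obtain ⟨q, -, hq⟩ := exists_eq_smul_of_isIsogeny_of_finrank_neronSeveriGroup_eq_one hA hρ
  exact (mem_orbit_ratSimPoints_iff_exists_isIsogeny Z Z').2 ⟨A, hA, q, hq⟩

end PicardOne

end SiegelModuli

end Literature.AlgebraicGeometry.ModuliOfAbelianVarieties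

end
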